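import Mathlib
import HarnessLib
import Summits.NavierStokesRegularity.NavierStokesRegularity.Theorems.PoloidalWindowDoorLrcModEntireQ4SonicHotSheet
import Summits.NavierStokesRegularity.NavierStokesRegularity.Theorems.PoloidalWindowDoorLrcModEntireTwistingTHHotPointPins

/-!
# Route `PoloidalWindowDoor`, item `LrcModEntire` (stmt-NavierStokesRegularity-20428), cell (Q4-sonic) of the (TH) column —
# THE HOT SHEET CARRIES ALL HOT-POINT PINS (any branch shape)

Cell ns-regularity-ideate, LEAD-lineage seat ns-poloidal-K2-p3 g16 (`--supports stmt-NavierStokesRegularity-20428`; memo `Cruxes/LrcModEntire/T2B-g16-sonic.md` §2(b)).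
`…Q4SonicHotSheet.sonic_web_point_hot` makes every web point of the sonic cell a hot point; the hot-point pins of `…TwistingTHHotPointPins` (gradient pin, time pin,
Laplacian pin — stated at an arbitrary hot point `y` with `U₂(−1,y) = U₂(−1,0)`) therefore hold on the whole 2-D web sheet, and the slope law kills the vertical shear
there.  `sonic_web_point_pins` packages: `U₂(−1,W) = U₂(−1,0)`, `∇U₂(−1,·)(W) = 0`, `∂ₜU₂(−1,W) = U₂(−1,0)/2`, `U₂(−1,0)·ΔU₂(−1,·)(W) ≤ 0`, `∂₂U_b(−1,W) = 0` (`b ≠ 2`)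
at every web point `W = Γ s + n₀ν_Γ s + z e₂` of the sonic cell — the data of the «hot NULL sheet» the residual stubs `stub_Q4sonicLineNeg` / `stub_Q4sonicCurved` of
twist_split v11 must kill (refuter MODEL O′).

WHAT THIS IS NOT: not a claim about Navier–Stokes regularity — structure of the hypothetical object of a research cell; items 20428 / 19708 / 27893 OPEN.
-/

noncomputable section

set_option linter.dupNamespace false
set_option linter.unusedVariables false

namespace Summit.NavierStokesRegularity.NavierStokesRegularity.Theorems.PoloidalWindowDoorLrcModEntireQ4SonicHotSheetPins

open Set Function Filter Topology Metric
open scoped RealInnerProductSpace InnerProductSpace Laplacian ContDiff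
open Literature.Analysis Literature.Analysis.FluidPDE Literature.Analysis.UnboundedOperators
open Summit.NavierStokesRegularity.NavierStokesRegularity.Theorems.PoloidalWindowDoorLrcModEntireQ4SonicHotSheet
open Summit.NavierStokesRegularity.NavierStokesRegularity.Theorems.PoloidalWindowDoorLrcModEntireTwistingTHHotPointPins

/-- **All hot-point pins on the web sheet of the sonic cell.**  Class profile `U` with the hot bound, hot branch `Γ`, sign `σ`, web Fermat law at `τ = 0`, sonic
`R(0,·)`, and the slab slope law at `t = −1`; `W` a web point at height `|z| < δ` with `|z| < ρ`. -/
theorem sonic_web_point_pins {C : ℝ} {U : ℝ → EuclideanSpace ℝ (Fin 3) → EuclideanSpace ℝ (Fin 3)} {Γ νΓ : ℝ → EuclideanSpace ℝ (Fin 3)} {R μ : ℝ → ℝ → ℝ}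
    {σ r δ ρ : ℝ}
    (hUrate : HasTypeITimeDecay C U) (hUcont : ContinuousOn (uncurry U) (Iio (0 : ℝ) ×ˢ univ))
    (hUmild : ∀ s t : ℝ, s < t → t < 0 → ∀ x, U t x = heatExtension (U s) (t - s) x - oseenDuhamel 1 s U U t x)
    (hUdiv : ∀ t < 0, VectorCalculus.IsDivFree (U t))
    (hUne : U (-1) 0 2 ≠ 0) (hUhotbd : ∀ t < 0, ∀ x, Real.sqrt (-t) * |U t x 2| ≤ |U (-1) 0 2|)
    (hσ : σ = 1 ∨ σ = -1) (hσN : σ * U (-1) 0 2 = |U (-1) 0 2|) (hΓhot : ∀ s, U (-1) (Γ s) 2 = U (-1) 0 2)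
    (hr : 0 < r) (hδ : 0 < δ)
    (hweb : ∀ z₀ : ℝ, |z₀| < δ → ∀ s₀ : ℝ, ∃ n₀ ∈ Ioo (-r) r,
      σ * U (-1) (Γ s₀ + n₀ • νΓ s₀ + z₀ • EuclideanSpace.single 2 (1 : ℝ)) 2 = R 0 z₀ ∧
      (∀ n ∈ Icc (-r) r, n ≠ n₀ → σ * U (-1) (Γ s₀ + n • νΓ s₀ + z₀ • EuclideanSpace.single 2 (1 : ℝ)) 2 < R 0 z₀))
    (hson : ∃ a b : ℝ, ∀ z : ℝ, |z| < δ → R 0 z = a + b * z)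
    (hslabU1 : ∀ x : EuclideanSpace ℝ (Fin 3), |x 2| < ρ → ∀ b : Fin 3, b ≠ 2 →
      fderiv ℝ (U (-1)) x (EuclideanSpace.single 2 1) b = μ (-1) (x 2) * fderiv ℝ (U (-1)) x (EuclideanSpace.single b 1) 2)
    (hΓ2 : ∀ s, Γ s 2 = 0) (hν2 : ∀ s, νΓ s 2 = 0)
    {z : ℝ} (hz : |z| < δ) (hzρ : |z| < ρ) (s : ℝ) {n₀ : ℝ}
    (hn₀ : σ * U (-1) (Γ s + n₀ • νΓ s + z • EuclideanSpace.single 2 (1 : ℝ)) 2 = R 0 z) :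
    U (-1) (Γ s + n₀ • νΓ s + z • EuclideanSpace.single 2 (1 : ℝ)) 2 = U (-1) 0 2 ∧
      (∀ h : EuclideanSpace ℝ (Fin 3), fderiv ℝ (U (-1)) (Γ s + n₀ • νΓ s + z • EuclideanSpace.single 2 (1 : ℝ)) h 2 = 0) ∧
      deriv (fun t => U t (Γ s + n₀ • νΓ s + z • EuclideanSpace.single 2 (1 : ℝ)) 2) (-1) = U (-1) 0 2 / 2 ∧
      U (-1) 0 2 * (Δ (fun w => U (-1) w 2)) (Γ s + n₀ • νΓ s + z • EuclideanSpace.single 2 (1 : ℝ)) ≤ 0 ∧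
      (∀ b : Fin 3, b ≠ 2 → fderiv ℝ (U (-1)) (Γ s + n₀ • νΓ s + z • EuclideanSpace.single 2 (1 : ℝ)) (EuclideanSpace.single 2 1) b = 0) := by
  set W := Γ s + n₀ • νΓ s + z • EuclideanSpace.single 2 (1 : ℝ) with hW
  have hhot := (sonic_web_point_hot hUhotbd hσ hσN hΓhot hr hδ hweb hson hz s hn₀).1
  have hσ0 : σ ≠ 0 := by rcases hσ with h | h <;> simp [h]
  have hy : U (-1) W 2 = U (-1) 0 2 := by
    have h : σ * U (-1) W 2 = σ * U (-1) 0 2 := by rw [hhot, hσN]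
    exact mul_left_cancel₀ hσ0 h
  have hgrad : ∀ h : EuclideanSpace ℝ (Fin 3), fderiv ℝ (U (-1)) W h 2 = 0 := fun h =>
    gradPin_of_hotPoint hUrate hUcont hUmild hUdiv hUhotbd hy h
  have hW2 : W 2 = z := by
    simp [hW, hΓ2 s, hν2 s]
  refine ⟨hy, hgrad, timePin_of_hotPoint hUrate hUcont hUmild hUdiv hUne hUhotbd hy,
    laplacianPin_of_hotPoint hUrate hUcont hUmild hUdiv hUne hUhotbd hy, fun b hb => ?_⟩
  rw [hslabU1 W (by rw [hW2]; exact hzρ) b hb, hgrad, mul_zero]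

end Summit.NavierStokesRegularity.NavierStokesRegularity.Theorems.PoloidalWindowDoorLrcModEntireQ4SonicHotSheetPins

end
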